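/-
Copyright (c) 2026. All rights reserved.
Released under Apache 2.0 license as described in the file LICENSE.
Authors: abc-iut cell, block C / W6 prover seat abc-iut-w6-d060 (gen 2).
-/
import Literature.IUT.LogVolume.UnitLogBallVolumeCriterion
import Literature.IUT.LogVolume.UnitLogBoundaryRamificationRoots
import HarnessLib

/-!
# `log_2(𝒪_K^×)` at ODD ramification index `e ≥ 3` over `ℚ_2`: it meets the sphere `‖z‖ = ‖ϖ‖`, hence NO ball
# is `2^k·log_2(𝒪_K^×)`

PROOF-ONLY file (no `def`, no named fact); the dyadic companion of `UnitLogDeepRamification` (odd `p`, `e ≥ p`).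
Setting: `K` a proper ultrametric normed `ℚ_2`-algebra, `e = absRamificationIdx 2 K` ODD and `≥ 3`, `ϖ` a
uniformizer (`‖ϖ‖^e = 1/2`), `n := (e + 1)/2`.

* `norm_one_add_pow_sq_sub_one_eq`: `‖(1 + ϖ^n)² − 1‖ = ‖ϖ‖^{2n}` (`(1+x)² − 1 = 2x + x²` and `‖2x‖ = ‖ϖ‖^{e+n} <
  ‖ϖ‖^{2n}` since `n < e`);
* `norm_logSeries_one_add_pow_sq_eq`: `‖log_2((1 + ϖ^n)²)‖ = ‖ϖ‖^{2n}` — radius `‖ϖ‖^{2n} = 2^{−(e+1)/e} < 1/2` is in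
  the isometry range of `log_2` (contraction modulus `2·‖ϖ‖^{2n} = ‖ϖ‖ < 1`);
* `norm_logSeries_one_add_pow_eq`: hence `‖log_2(1 + ϖ^n)‖ = ‖ϖ‖^{2n}/‖2‖ = ‖ϖ‖` EXACTLY: `log_2(𝒪_K^×)` has an
  element on the sphere `‖z‖ = ‖ϖ‖` (`exists_mem_logUnits_norm_eq`), so `log_2(𝒪_K^×) ⊄ 𝔪_K²`;
* `closedBall_ne_zpow_smul_logUnits_of_odd`: **NO ball `{‖y‖ ≤ ‖ϖ‖^j}` is `2^k·log_2(𝒪_K^×)`** — abc-iut-w5-d039's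
  volume constraint `m = f·(j − ke − 1)` (`UnitLogBallVolumeCriterion`, [IUTchIV] Prop. 1.4 (ii)) with `m ≥ 1`
  (`−1 ∈ K`) would force `log_2(𝒪_K^×) = 𝔪^{1+m/f} ⊆ 𝔪²`.

(For EVEN `e` over `2` the unit ball can be fixed in exactly three shapes — abc-iut-w5-d039's dyadic census; this
file says nothing there.)  Consequence for Dupuy–Hilado's (Ind2) (`Thm311RealIsmDHMoverCriterion`, abc-iut-w5-d180):
at a place `v | 2` with `e(v|2)` odd `≥ 3` EVERY ball `t·𝒪_v` is moved.  References:
[cite: NeukirchANT1999, Ch. II Prop. (5.5)–(5.7)] [cite: Koblitz1984, Ch. IV §1–2]; `logUnits` is the cell's typing of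
[IUTchIV] Prop. 1.2's `log_p(R^×)` ([claim: Mochizuki2012, status: disputed] for that locution).
-/

noncomputable section

open Metric Set IsUltrametricDist
open scoped Pointwise

namespace Literature.IUT.LogVolume

open Literature.NumberTheory.GaloisRepresentations.Ultrametric Literature.NumberTheory.Transcendental

namespace DyadicOddRamification

variable [h2 : Fact (Nat.Prime 2)]
variable {K : Type*} [NontriviallyNormedField K] [instK : NormedAlgebra ℚ_[2] K] [IsUltrametricDist K]
  [ProperSpace K]
variable {ϖ : Kˣ} (hϖ : IsUniformizer ϖ)
include hϖ

/-! ## 1. The test unit `1 + ϖ^n`, `n = (e + 1)/2` -/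

/-- `‖(1 + ϖ^n)² − 1‖ = ‖ϖ‖^{2n}` for `e` odd `≥ 3`, `n = (e+1)/2` (`(1+x)² − 1 = 2x + x²`, `‖2x‖ < ‖x²‖`).
[cite: NeukirchANT1999, Ch. II Prop. (5.5)] -/
theorem norm_one_add_pow_sq_sub_one_eq (hodd : Odd (absRamificationIdx 2 K)) (he : 3 ≤ absRamificationIdx 2 K) :
    ‖(1 + (ϖ : K) ^ ((absRamificationIdx 2 K + 1) / 2)) ^ 2 - 1‖ =
      ‖(ϖ : K)‖ ^ (2 * ((absRamificationIdx 2 K + 1) / 2)) := by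
  set e := absRamificationIdx 2 K with he_def
  set n := (e + 1) / 2 with hn_def
  set r := ‖(ϖ : K)‖ with hr
  obtain ⟨k, hk⟩ := hodd
  have hn : 2 * n = e + 1 := by omega
  have hr0 : 0 < r := norm_units_pos ϖ
  have hr1 : r < 1 := hϖ.norm_lt_one
  set x : K := (ϖ : K) ^ n with hx
  have hrew : (1 + x) ^ 2 - 1 = x ^ 2 + (2 : K) * x := by ring
  have hbig : ‖x ^ 2‖ = r ^ (2 * n) := by rw [norm_pow, hx, norm_pow, ← pow_mul, mul_comm]
  have hsmall : ‖(2 : K) * x‖ < r ^ (2 * n) := by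
    have h2n : ‖(2 : K)‖ = r ^ e := by exact_mod_cast norm_prime_eq_norm_pow 2 K hϖ
    rw [norm_mul, h2n, hx, norm_pow, ← pow_add]
    exact pow_lt_pow_right_of_lt_one₀ hr0 hr1 (by omega)
  rw [hrew, norm_add_eq_max_of_norm_ne_norm (by rw [hbig]; exact hsmall.ne'), hbig, max_eq_left hsmall.le]

/-- **`‖log_2((1 + ϖ^n)²)‖ = ‖ϖ‖^{2n}`** (`e` odd `≥ 3`, `n = (e+1)/2`): the contraction modulus at radius
`‖ϖ‖^{2n} = ‖ϖ‖^{e+1}` is `2·‖ϖ‖^{e+1} = ‖ϖ‖ < 1`. [cite: Koblitz1984, Ch. IV §2] [cite: NeukirchANT1999, Ch. II Prop. (5.5)] -/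
theorem norm_logSeries_one_add_pow_sq_eq (hodd : Odd (absRamificationIdx 2 K)) (he : 3 ≤ absRamificationIdx 2 K) :
    ‖logSeries ((1 + (ϖ : K) ^ ((absRamificationIdx 2 K + 1) / 2)) ^ 2)‖ =
      ‖(ϖ : K)‖ ^ (2 * ((absRamificationIdx 2 K + 1) / 2)) := by
  set e := absRamificationIdx 2 K with he_def
  set n := (e + 1) / 2 with hn_def
  set r := ‖(ϖ : K)‖ with hr
  have hodd' := hodd
  obtain ⟨k, hk⟩ := hodd
  have hn : 2 * n = e + 1 := by omega
  have hr0 : 0 < r := norm_units_pos ϖ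
  have hr1 : r < 1 := hϖ.norm_lt_one
  set y : K := (1 + (ϖ : K) ^ n) ^ 2 with hy
  have h1y : ‖1 - y‖ = r ^ (2 * n) := by
    rw [← norm_neg, neg_sub, hy]; exact norm_one_add_pow_sq_sub_one_eq hϖ hodd' he
  -- contraction modulus: `r^(2n) * 2^(1/(2-1)) = r^(e+1) * 2 = r`
  have h2e : r ^ e = (2 : ℝ)⁻¹ := by exact_mod_cast norm_pow_absRamificationIdx 2 K hϖ
  have hθ : r ^ (2 * n) * ((2 : ℕ) : ℝ) ^ (1 / (((2 : ℕ) : ℝ) - 1)) = r := by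
    have : ((2 : ℕ) : ℝ) ^ (1 / (((2 : ℕ) : ℝ) - 1)) = 2 := by norm_num
    rw [this, hn, pow_succ, h2e]
    field_simp
  have hθ1 : r ^ (2 * n) * ((2 : ℕ) : ℝ) ^ (1 / (((2 : ℕ) : ℝ) - 1)) < 1 := by rw [hθ]; exact hr1
  have hcontr := norm_logSeries_add_le 2 K hθ1.le (le_of_eq h1y)
  have hlt : ‖logSeries y + (1 - y)‖ < ‖1 - y‖ := by
    refine hcontr.trans_lt ?_
    rw [hθ, h1y, hn, pow_succ]
    exact mul_lt_of_lt_one_left (by positivity) hr1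
  have hsplit : logSeries y = (logSeries y + (1 - y)) + (-(1 - y)) := by ring
  rw [hsplit, norm_add_eq_max_of_norm_ne_norm (by rw [norm_neg]; exact hlt.ne), norm_neg,
    max_eq_right hlt.le, h1y]

/-- **`‖log_2(1 + ϖ^n)‖ = ‖ϖ‖` exactly** (`e` odd `≥ 3`, `n = (e+1)/2`; `log_2(y²) = 2·log_2 y`, `‖2‖ = ‖ϖ‖^e`).
[cite: NeukirchANT1999, Ch. II Prop. (5.5)] -/
theorem norm_logSeries_one_add_pow_eq (hodd : Odd (absRamificationIdx 2 K)) (he : 3 ≤ absRamificationIdx 2 K) :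
    ‖logSeries (1 + (ϖ : K) ^ ((absRamificationIdx 2 K + 1) / 2))‖ = ‖(ϖ : K)‖ := by
  set e := absRamificationIdx 2 K with he_def
  set n := (e + 1) / 2 with hn_def
  set r := ‖(ϖ : K)‖ with hr
  have hodd' := hodd
  obtain ⟨k, hk⟩ := hodd
  have hn : 2 * n = e + 1 := by omega
  have hr0 : 0 < r := norm_units_pos ϖ
  have hr1 : r < 1 := hϖ.norm_lt_one
  have hP : ‖1 - (1 + (ϖ : K) ^ n)‖ < 1 := by
    rw [sub_add_cancel_left, norm_neg, norm_pow]
    exact pow_lt_one₀ hr0.le hr1 (by omega)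
  have hpow := logSeries_pow 2 hP 2
  have hnorm := norm_logSeries_one_add_pow_sq_eq hϖ hodd' he
  rw [hpow, norm_mul] at hnorm
  have h2n : ‖((2 : ℕ) : K)‖ = r ^ e := by exact_mod_cast norm_prime_eq_norm_pow 2 K hϖ
  rw [h2n, hn, pow_succ] at hnorm
  exact mul_left_cancel₀ (pow_pos hr0 e).ne' hnorm

/-- **`log_2(𝒪_K^×)` meets the sphere `‖z‖ = ‖ϖ‖`** (`e` odd `≥ 3`): in particular `log_2(𝒪_K^×) ⊄ 𝔪_K²`.
[cite: NeukirchANT1999, Ch. II Prop. (5.5)] -/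
theorem exists_mem_logUnits_norm_eq (hodd : Odd (absRamificationIdx 2 K)) (he : 3 ≤ absRamificationIdx 2 K) :
    ∃ z ∈ logUnits K, ‖z‖ = ‖(ϖ : K)‖ := by
  set n := (absRamificationIdx 2 K + 1) / 2 with hn_def
  have hr0 : 0 < ‖(ϖ : K)‖ := norm_units_pos ϖ
  have hP : IsPrincipal (1 + (ϖ : K) ^ n) := by
    rw [IsPrincipal, sub_add_cancel_left, norm_neg, norm_pow]
    exact pow_lt_one₀ hr0.le hϖ.norm_lt_one (by omega)
  refine ⟨logSeries (1 + (ϖ : K) ^ n), ?_, norm_logSeries_one_add_pow_eq hϖ hodd he⟩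
  rw [← unitLog_of_isPrincipal 2 hP]
  exact unitLog_mem_logUnits hP.norm_eq_one

/-! ## 2. No ball is `2^k·log_2(𝒪_K^×)` -/

omit hϖ in
/-- Over `ℚ_2` the `2`-primary torsion of `𝒪_K^×` is non-trivial (`−1 ≠ 1`): `m = torsionPExp 2 K ≥ 1`.
[cite: NeukirchANT1999, Ch. II Prop. (5.7)] -/
theorem one_le_torsionPExp_two : 1 ≤ torsionPExp 2 K := by
  haveI := IwasawaLog.charZero 2 (F := K)
  by_contra h
  have hm : torsionPExp 2 K = 0 := by omega
  have h1 := forall_pow_prime_eq_one_of_torsionPExp_eq_zero 2 K hm (-1) (by norm_num)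
  norm_num at h1

/-- **At `e` odd `≥ 3` over `ℚ_2`: NO ball `{‖y‖ ≤ ‖ϖ‖^j}` equals `2^k·log_2(𝒪_K^×)`** (`j, k ∈ ℤ`): the volume constraint
`m = f·(j − ke − 1)` with `m ≥ 1` would give `log_2(𝒪_K^×) = 𝔪^{j−ke} ⊆ 𝔪²`, contradicting the element of norm `‖ϖ‖`.
[cite: NeukirchANT1999, Ch. II Prop. (5.5)–(5.7)] [cite: WeilBNT1967, Ch. II §2, Th. 1–2] -/
theorem closedBall_ne_zpow_smul_logUnits_of_odd (hodd : Odd (absRamificationIdx 2 K))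
    (he : 3 ≤ absRamificationIdx 2 K) (j k : ℤ) :
    closedBall (0 : K) (‖(ϖ : K)‖ ^ j) ≠ (((2 : ℕ) : ℚ_[2]) ^ k) • logUnits K := by
  intro h
  have hr0 : 0 < ‖(ϖ : K)‖ := norm_units_pos ϖ
  have hϖ0 : ‖(ϖ : K)‖ ≠ 0 := hr0.ne'
  have hm := torsionPExp_eq_of_closedBall_eq_zpow_smul_logUnits 2 K hϖ h
  have hf : (0 : ℤ) < residueDegree 2 K := by exact_mod_cast residueDegree_pos 2 K
  have hm1 : (1 : ℤ) ≤ torsionPExp 2 K := by exact_mod_cast one_le_torsionPExp_two (K := K)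
  have hjk : 2 ≤ j - k * absRamificationIdx 2 K := by
    by_contra hlt
    rw [not_le] at hlt
    have : (residueDegree 2 K : ℤ) * (j - k * absRamificationIdx 2 K - 1) ≤ 0 :=
      mul_nonpos_of_nonneg_of_nonpos hf.le (by omega)
    omega
  have hΛ : logUnits K = closedBall (0 : K) (‖(ϖ : K)‖ ^ (j - k * absRamificationIdx 2 K)) := by
    rw [(closedBall_eq_zpow_smul_iff 2 K _ k _).1 h]
    congr 1
    rw [zpow_sub₀ hϖ0, mul_comm k, zpow_mul, zpow_natCast, norm_pow_absRamificationIdx 2 K hϖ, inv_zpow',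
      zpow_neg, div_inv_eq_mul, mul_comm]
  obtain ⟨z, hz, hzn⟩ := exists_mem_logUnits_norm_eq hϖ hodd he
  rw [hΛ, mem_closedBall, dist_zero_right, hzn] at hz
  have hlt : ‖(ϖ : K)‖ ^ (j - k * absRamificationIdx 2 K) < ‖(ϖ : K)‖ ^ (1 : ℤ) :=
    zpow_lt_zpow_right_of_lt_one₀ hr0 hϖ.norm_lt_one (by omega)
  rw [zpow_one] at hlt
  exact absurd hz (not_le.mpr hlt)

/-- The same for the ball `{‖y‖ ≤ ‖t‖}` of any `t ≠ 0`. [cite: NeukirchANT1999, Ch. II Prop. (5.5)–(5.7)]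
[cite: WeilBNT1967, Ch. II §2, Th. 1–2] -/
theorem closedBall_norm_ne_zpow_smul_logUnits_of_odd (hodd : Odd (absRamificationIdx 2 K))
    (he : 3 ≤ absRamificationIdx 2 K) {t : K} (ht : t ≠ 0) (k : ℤ) :
    closedBall (0 : K) ‖t‖ ≠ (((2 : ℕ) : ℚ_[2]) ^ k) • logUnits K := by
  obtain ⟨j, hj⟩ := hϖ.2 (Units.mk0 t ht)
  rw [Units.val_mk0] at hj
  rw [hj]
  exact closedBall_ne_zpow_smul_logUnits_of_odd hϖ hodd he j k

end DyadicOddRamification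

end Literature.IUT.LogVolume

end
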